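import Literature.MathematicalPhysics.QuantumFieldTheory.Balaban1983to89.Setup
import HarnessLib

/-!
# S2β · D-GUARD ∕ (BG∞) — THE ČECH TRANSITION OF TWO GAUGES IS LIPSCHITZ BY THE TWO GAUGED BONDS
# (Step B (B2) of UV3-NODE §116.3: the site cocycle `t_{QQ′} := u_Q·u_{Q′}⁻¹` of two local small-bond gauges moves, along a bond, by at most the
# two gauged bond variables)

Cell `ym3-torus` (YM ladder rung R3 = continuum `SU(2)` Yang–Mills on the three-torus at fixed lattice data — a RUNG: NOT d = 4, NOT infinite volume,
NOT a mass gap, NOT Clay).  Width seat «width 19» `ym3-torus-px19` (gen 25, ★p1 lineage), FREE px helper on crux `stmt-QuantumFields-20520`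
(`FluctuationComparisonRegPrIntL`; registry `Lines/semiclassical_s2beta.lean` UNTOUCHED, 0∕5); `--kind proof --supports stmt-QuantumFields-20520 --as helper`,
count-neutral, DEFINITION-FREE (0 `def`, 0 `instance`, 0 `notation`, 0 `sorry`, default heartbeats).  NAMED by the architect-lineage ruling «(BG∞) PLAN OF
RECORD = UV3-NODE §116» (px17 g23, STATUS 2026-09-01T00:13:02Z: «px19 g25 ← (G2) + (G5), GO»).

WHY.  The (BG∞) road to D-GUARD's floored supplier (LEAD w3 g29 `…FlooredSupplierOfSqrtGauge.hsupp_floor_of_sqrtGauge`, binder `hBG`: an `N`-uniform small-bond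
gauge `arc ≤ C√θ + c∕N` from plaquettes `< θ`) is the construction of UV3-NODE §116.3: local axial gauges `u_Q` on closed blocks `Q̄` of side `ρ ≍ θ^{−1∕2}`
(Step A, on the tree: ✓`AlphaInputsT3ACv3RegionAxialGauge.dist1_gaugeActT_axialT_le_pi_of_box`), the exact site cocycle `t_{QQ′}(x) := u_Q(x)·u_{Q′}(x)⁻¹` on
shared sites (Step B), and Lipschitz sections of that cocycle by an 8-colour filling (Step C).  Step C's input is (B2): along every bond `b = ⟨x, μ⟩` of a shared
face the transition moves by at most the two gauged bond variables, `dist1(t(x)⁻¹·t(x + e_μ)) ≤ dist1((u_Q•V) b) + dist1((u_{Q′}•V) b) ≤ 2δ`.  THIS FILE is exactly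
that sentence, for any `[GaugeGroup G]` (and the identity behind it for any group).

WHAT IS PROVED (sorry-free).
* ★ `transition_tgt_eq` — the identity `u(y)·u′(y)⁻¹ = ((u•V) b)⁻¹ · (u(x)·u′(x)⁻¹) · ((u′•V) b)` at `x = b.src`, `y = b.tgt` (any `Group`).
* ★★ `dist1_transition_step_le` — `dist1 ((u x·(u′ x)⁻¹)⁻¹ · (u y·(u′ y)⁻¹)) ≤ dist1 ((u•V) b) + dist1 ((u′•V) b)`; ★ `dist1_transition_step_le'` — the same for
  `(u x·(u′ x)⁻¹) · (u y·(u′ y)⁻¹)⁻¹` (conjugation ∕ inversion invariance of `dist1`).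
* ★ `dist1_transition_step_le_two_mul` — with both gauged bonds `≤ δ`: `≤ 2δ` ((B2) as displayed in §116.3).

HONEST SCOPE.  Group bookkeeping; no lattice geometry beyond `b.src ∕ b.tgt`; nothing of Bałaban's renormalisation-group analysis is asserted or proved
([Balaban1985Averaging] (8)–(9) p.18: the gauge action on bond variables; [Balaban1985RegularSpaces] Lemma 1 p.79: the local axial gauges this transition compares).
(BG∞) ∕ `hsupp⁺` is a CONJECTURE (LEAD §114.3; FL-39 j345235 numerically alive) and is NOT proved here; GAP♯∘ (`stub_uniformFibreGapOrbit`, registry UNTOUCHED), the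
five registered stubs (0∕5), S2β, crux 20520, 19936, 19200, `YM3TorusSU2` are NOT proved; no registered stub is closed; rung R3 — NOT d = 4, NOT infinite volume,
NOT a mass gap, NOT Clay; the Yang–Mills mass gap is NOT proved.  Axioms standard.

References: T. Bałaban, CMP **98** (1985) 17–51 [Balaban1985Averaging] ((8)–(9) p.18); CMP **99** (1985) 75–102 [Balaban1985RegularSpaces] (Lemma 1 p.79, (1.29) p.81).
-/

set_option autoImplicit false

namespace Summit.QuantumFields.YangMills.Theorems.FluctuationComparisonRegPrIntLS2BetaGaugeTransitionStep

open Literature.MathematicalPhysics.QuantumFieldTheory.Balaban1983to89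

variable {P : Params} {j : ℕ}

section AnyGroup
variable {G : Type*} [Group G]

/-- ★ **THE TRANSITION IDENTITY**: for two gauges `u, u′`, a field `V` and a bond `b` from `x = b.src` to `y = b.tgt`, the Čech transition `t := u·u′⁻¹`
satisfies `t(y) = ((u•V) b)⁻¹ · t(x) · ((u′•V) b)` — the two gauged copies of `V b` conjugate `t` along the bond. [cite: Balaban1985Averaging, (8) p.18] -/
theorem transition_tgt_eq (u u' : GaugeTransf P j G) (V : GaugeField P j G) (b : PBond P j) :
    u b.tgt * (u' b.tgt)⁻¹ =
      (u b.src * V b * (u b.tgt)⁻¹)⁻¹ * (u b.src * (u' b.src)⁻¹) * (u' b.src * V b * (u' b.tgt)⁻¹) := by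
  group

end AnyGroup

section Dist
variable {G : Type*} [GaugeGroup G]

/-- The same identity with the gauged fields spelled `GaugeField.gaugeAct`. [cite: Balaban1985Averaging, (8) p.18] -/
theorem transition_tgt_eq_gaugeAct (u u' : GaugeTransf P j G) (V : GaugeField P j G) (b : PBond P j) :
    u b.tgt * (u' b.tgt)⁻¹ =
      (GaugeField.gaugeAct u V b)⁻¹ * (u b.src * (u' b.src)⁻¹) * GaugeField.gaugeAct u' V b :=
  transition_tgt_eq u u' V b

/-- `dist1 (a⁻¹ · h⁻¹ · a · g) ≤ dist1 h + dist1 g`: a conjugated inverse costs `dist1 h`. [cite: Balaban1985Averaging, (19)-(20) p.21] -/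
theorem dist1_inv_mul_conj_mul_le (a h g : G) : dist1 (a⁻¹ * h⁻¹ * a * g) ≤ dist1 h + dist1 g := by
  have h1 : dist1 (a⁻¹ * h⁻¹ * a) = dist1 h := by
    have := GaugeGroup.dist1_conj h⁻¹ a⁻¹
    rw [inv_inv] at this
    rw [this, GaugeGroup.dist1_inv]
  calc dist1 (a⁻¹ * h⁻¹ * a * g) ≤ dist1 (a⁻¹ * h⁻¹ * a) + dist1 g := GaugeGroup.dist1_mul_le _ _
    _ = dist1 h + dist1 g := by rw [h1]

/-- ★★ **THE TRANSITION STEP IS BOUNDED BY THE TWO GAUGED BONDS** ((B2) of UV3-NODE §116.3): with `t := u·u′⁻¹`,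
`dist1 (t(x)⁻¹ · t(y)) ≤ dist1 ((u•V) b) + dist1 ((u′•V) b)` for the bond `b` from `x` to `y`. [cite: Balaban1985RegularSpaces, Lemma 1 p.79] -/
theorem dist1_transition_step_le (u u' : GaugeTransf P j G) (V : GaugeField P j G) (b : PBond P j) :
    dist1 ((u b.src * (u' b.src)⁻¹)⁻¹ * (u b.tgt * (u' b.tgt)⁻¹)) ≤
      dist1 (GaugeField.gaugeAct u V b) + dist1 (GaugeField.gaugeAct u' V b) := by
  rw [transition_tgt_eq_gaugeAct u u' V b]
  set a := u b.src * (u' b.src)⁻¹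
  set h := GaugeField.gaugeAct u V b
  set g := GaugeField.gaugeAct u' V b
  have e : a⁻¹ * (h⁻¹ * a * g) = a⁻¹ * h⁻¹ * a * g := by group
  rw [e]
  exact dist1_inv_mul_conj_mul_le a h g

/-- ★ The same step in the form `dist1 (t(x) · t(y)⁻¹)`. [cite: Balaban1985RegularSpaces, Lemma 1 p.79] -/
theorem dist1_transition_step_le' (u u' : GaugeTransf P j G) (V : GaugeField P j G) (b : PBond P j) :
    dist1 ((u b.src * (u' b.src)⁻¹) * (u b.tgt * (u' b.tgt)⁻¹)⁻¹) ≤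
      dist1 (GaugeField.gaugeAct u V b) + dist1 (GaugeField.gaugeAct u' V b) := by
  set a := u b.src * (u' b.src)⁻¹ with ha
  set c := u b.tgt * (u' b.tgt)⁻¹ with hc
  have e : a * c⁻¹ = a * (a⁻¹ * c)⁻¹ * a⁻¹ := by group
  rw [e, GaugeGroup.dist1_conj, GaugeGroup.dist1_inv]
  exact dist1_transition_step_le u u' V b

/-- ★ **(B2) AS DISPLAYED**: if both gauged bond variables are within `δ` of `1`, the transition moves by at most `2δ` along the bond.
[cite: Balaban1985RegularSpaces, Lemma 1 p.79, (1.29) p.81] -/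
theorem dist1_transition_step_le_two_mul (u u' : GaugeTransf P j G) (V : GaugeField P j G) (b : PBond P j) {δ : ℝ}
    (hu : dist1 (GaugeField.gaugeAct u V b) ≤ δ) (hu' : dist1 (GaugeField.gaugeAct u' V b) ≤ δ) :
    dist1 ((u b.src * (u' b.src)⁻¹)⁻¹ * (u b.tgt * (u' b.tgt)⁻¹)) ≤ 2 * δ := by
  have h := dist1_transition_step_le u u' V b
  linarith

end Dist

end Summit.QuantumFields.YangMills.Theorems.FluctuationComparisonRegPrIntLS2BetaGaugeTransitionStep
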